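import Mathlib
import Summits.AtomisticToContinuum.Crystallization.Theses.ChartedPlanarOrder
import Summits.AtomisticToContinuum.Crystallization.Theses.MatrixSaturationDichotomy
import Summits.AtomisticToContinuum.Crystallization.Theses.HullMinimality
import Summits.AtomisticToContinuum.Crystallization.Theses.NashClassCertificates
import Summits.AtomisticToContinuum.Crystallization.Theorems.ChartedPlanarOrderNnfDoor
import Summits.AtomisticToContinuum.Crystallization.Theorems.ChartedPlanarOrderLayeredHullPoint

/-!
# ChartedPlanarOrder — the Palm door of the clean branch (decomp-a2c lens-3, generation 8)

Tree twin of the cell node «MinimisingHullLaw» (run/shared/lean/pub/decomp-a2c/decomp-a2c-lens-3/g8/).  Sorry-free.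

* `cleanBallPlanarOrderGlue_proof` — PROVES the split glue item `ChartedPlanarOrder.CleanBallPlanarOrderGlue`
  (stmt-AtomisticToContinuum-33482): `CleanBallPlanarOrderMaj → CleanBallPlanarOrderMin → CleanBallPlanarOrder`
  (excluded middle on the bad-fraction clause `b_N → 0`).
* `cleanBallPlanarOrder_iff_maj_min` — the EQUIV of the node: `CleanBallPlanarOrder ↔ Maj ∧ Min`.
* `layeredWindowsAlong_of_palmDoor` — MinimisingLawTransfer (T, stmt-33484) → CleanLawsChargeLayers (L, stmt-33483) →
  layered windows (the hypothesis clause of `HullMinimality.PeriodicGivenLayered`, stmt-11779) along every ground-state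
  sequence with `b_N → 0`: composition of the transfer matching with the charged layered event (R ↦ R + ε + B + ε).
* `cleanBallPlanarOrderMaj_of_palmDoor` — T → L → `ChartedPlanarOrder.CleanBallPlanarOrderMaj` (stmt-33480), through
  the landed `stub_layeredHullPoint` (p773995); this is the registered line «palm-door»'s composition with the stubs as
  hypotheses.
* `periodicWindowsAlongCleanMajority_of_palmDoor` — with `PeriodicGivenLayered` (11779, closed) as a hypothesis by
  name: T → L → periodic windows along every ground-state sequence with `b_N → 0` (= lens-5's P₀ ∧ P₂ world).
* `cleanBallCase_of_nashNearField_direct` — CONSOLIDATION: `PeriodicGivenLayered → NashNearField →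
  MatrixSaturationDichotomy.CleanBallCase` per sequence, with NO lens-3 rung (the conclusion of the landed
  `stub_nnfDoor` is 11779's hypothesis clause verbatim).
-/

namespace Summit.AtomisticToContinuum.Crystallization.Theorems.ChartedPlanarOrderPalmDoor

open Filter

/-- The split glue item stmt-AtomisticToContinuum-33482, by excluded middle. [folklore] -/
theorem cleanBallPlanarOrderGlue_proof : Theses.ChartedPlanarOrder.CleanBallPlanarOrderGlue :=
  fun h₁ h₂ x hx hc hk hh => (Classical.em _).elim (h₁ x hx hc hk hh) (h₂ x hx hc hk hh)

/-- THE EQUIV of the g8 node: `CleanBallPlanarOrder` ⟺ its two excluded-middle halves. [folklore] -/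
theorem cleanBallPlanarOrder_iff_maj_min :
    Theses.ChartedPlanarOrder.CleanBallPlanarOrder ↔
      (Theses.ChartedPlanarOrder.CleanBallPlanarOrderMaj ∧ Theses.ChartedPlanarOrder.CleanBallPlanarOrderMin) :=
  ⟨fun h => ⟨fun x hx hc hk hh _ => h x hx hc hk hh, fun x hx hc hk hh _ => h x hx hc hk hh⟩,
    fun h => cleanBallPlanarOrderGlue_proof h.1 h.2⟩

/-- T ∧ L ⟹ layered windows along every ground-state sequence with `b_N → 0` (T = `ChartedPlanarOrder.MinimisingLawTransfer` stmt-33484,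
L = `ChartedPlanarOrder.CleanLawsChargeLayers` stmt-33483, route decls since rev 8). [folklore] -/
theorem layeredWindowsAlong_of_palmDoor
    (hT : Theses.ChartedPlanarOrder.MinimisingLawTransfer)
    (hL : Theses.ChartedPlanarOrder.CleanLawsChargeLayers) :
    ∀ x : (N : ℕ) → (Fin N → EuclideanSpace ℝ (Fin 3)), (∀ N, Literature.MathematicalPhysics.StatisticalMechanics.IsGroundState Literature.MathematicalPhysics.StatisticalMechanics.lennardJones (x N)) → Filter.Tendsto (fun N : ℕ => (Nat.card {i : Fin N // ¬ Literature.Geometry.DiscreteGeometry.IsTwoShellGood (1 / 20) (47 / 50) 1 (x N) i} : ℝ) / N) Filter.atTop (nhds 0) → ∃ a : ℝ, 47 / 50 ≤ a ∧ a ≤ 1 ∧ ∀ R ε : ℝ, 0 < ε → ∃ᶠ N in Filter.atTop, ∃ (A : EuclideanSpace ℝ (Fin 3) →ₗᵢ[ℝ] EuclideanSpace ℝ (Fin 3)) (t : EuclideanSpace ℝ (Fin 3)) (s : ℤ → ℤ) (z : ℤ → ℝ), Literature.MathematicalPhysics.StatisticalMechanics.IsHaggSeq s ∧ (∀ m : ℤ,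 39 / 50 * a ≤ z (m + 1) - z m ∧ z (m + 1) - z m ≤ 17 / 20 * a) ∧ let S : Set (EuclideanSpace ℝ (Fin 3)) := {p | ∃ m i j : ℤ, p = A (((i : ℝ) • Literature.MathematicalPhysics.StatisticalMechanics.triangularVec₁ a) + ((j : ℝ) • Literature.MathematicalPhysics.StatisticalMechanics.triangularVec₂ a) + ((Literature.MathematicalPhysics.StatisticalMechanics.haggLabel s m : ℝ) • Literature.MathematicalPhysics.StatisticalMechanics.barlowOffset a) + (z m • Literature.MathematicalPhysics.StatisticalMechanics.layerNormal 1))}; (∀ p ∈ S, ‖p‖ ≤ R → ∃ i : Fin N, dist (x N i + t) p ≤ ε) ∧ (∀ i : Fin N, ‖x N i + t‖ ≤ R → ∃ p ∈ S, dist (x N i + t) p ≤ ε) := by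
  intro x hx hb
  have key : ∀ u v : EuclideanSpace ℝ (Fin 3), ‖u‖ ≤ ‖v‖ + dist u v := fun u v => by
    have h := dist_triangle u v 0
    rw [dist_zero_right, dist_zero_right] at h
    linarith
  obtain ⟨δ, hδ, P, hP, hroot, hmecke, hen, hclean, hnash, htr⟩ := hT x hx hb
  obtain ⟨a, ha₁, ha₂, H⟩ := hL δ hδ P hP hroot hmecke hen hclean hnash
  refine ⟨a, ha₁, ha₂, ?_⟩
  intro R ε hε
  obtain ⟨B, hB⟩ := H (R + ε) (ε / 2) (by positivity)
  have hfreq := htr _ (R + ε + B + ε) (ε / 2) (by positivity) hB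
  refine hfreq.mono ?_
  rintro N ⟨i, ν, hν, hM₁, hM₂⟩
  simp only [Set.mem_setOf_eq] at hν
  obtain ⟨A, t, s, z, htB, hs, hz, hS₁, hS₂⟩ := hν
  have hB0 : 0 ≤ B := le_trans (norm_nonneg _) htB
  refine ⟨A, t - x N i, s, z, hs, hz, ?_, ?_⟩
  · intro p hp hpR
    obtain ⟨q, hq0, hqp⟩ := hS₁ p hp (by linarith)
    have hq1 : ‖q + t‖ ≤ R + ε / 2 := by
      have h1 := key (q + t) p
      linarith
    have hq2 : ‖q‖ ≤ R + ε + B + ε := by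
      have h2 : ‖q‖ ≤ ‖q + t‖ + ‖t‖ := by simpa using norm_sub_le (q + t) t
      linarith
    obtain ⟨q', hq', hd'⟩ := hM₁ q hq0 hq2
    obtain ⟨k, hk⟩ := Set.mem_range.mp hq'
    refine ⟨k, ?_⟩
    have e1 : x N k + (t - x N i) = (x N k - x N i) + t := by abel
    have hd'' : dist (x N k - x N i) q ≤ ε / 2 := by rw [hk]; exact hd'
    calc dist (x N k + (t - x N i)) p = dist ((x N k - x N i) + t) p := by rw [e1]
      _ ≤ dist ((x N k - x N i) + t) (q + t) + dist (q + t) p := dist_triangle _ _ _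
      _ = dist (x N k - x N i) q + dist (q + t) p := by rw [dist_add_right]
      _ ≤ ε / 2 + ε / 2 := add_le_add hd'' hqp
      _ = ε := by ring
  · intro k hk
    have e1 : x N k + (t - x N i) = (x N k - x N i) + t := by abel
    rw [e1] at hk ⊢
    have hmem : (x N k - x N i) ∈ Set.range (fun k : Fin N => x N k - x N i) := ⟨k, rfl⟩
    have hnorm : ‖x N k - x N i‖ ≤ R + ε + B + ε := by
      have h2 : ‖x N k - x N i‖ ≤ ‖x N k - x N i + t‖ + ‖t‖ := by
        simpa using norm_sub_le (x N k - x N i + t) t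
      linarith
    obtain ⟨p₀, hp₀, hd₀⟩ := hM₂ _ hmem hnorm
    have hp₀t : ‖p₀ + t‖ ≤ R + ε := by
      have h1 := key (p₀ + t) (x N k - x N i + t)
      rw [dist_add_right, dist_comm] at h1
      linarith
    obtain ⟨p, hpS, hd⟩ := hS₂ p₀ hp₀ hp₀t
    refine ⟨p, hpS, ?_⟩
    calc dist (x N k - x N i + t) p ≤ dist (x N k - x N i + t) (p₀ + t) + dist (p₀ + t) p := dist_triangle _ _ _
      _ = dist (x N k - x N i) p₀ + dist (p₀ + t) p := by rw [dist_add_right]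
      _ ≤ ε / 2 + ε / 2 := add_le_add hd₀ hd
      _ = ε := by ring

/-- T → L → `CleanBallPlanarOrderMaj` (stmt-33480): the registered line «palm-door» composed (landed
`stub_layeredHullPoint`: exact planar periods of length a are δ/4-almost periods, δ = 39a/50, r = 2a, b = a). [folklore] -/
theorem cleanBallPlanarOrderMaj_of_palmDoor :
    Theses.ChartedPlanarOrder.MinimisingLawTransfer →
    Theses.ChartedPlanarOrder.CleanLawsChargeLayers →
    Summit.AtomisticToContinuum.Crystallization.Theses.ChartedPlanarOrder.CleanBallPlanarOrderMaj := by
  intro hT hL x hx _hc _hk _hh hb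
  obtain ⟨a, ha₁, ha₂, hW⟩ := layeredWindowsAlong_of_palmDoor hT hL x hx hb
  obtain ⟨X, t₁, t₂, hsep, hdense, hhull, ht₁, ht₂, hind, hper⟩ :=
    Summit.AtomisticToContinuum.Crystallization.Theorems.ChartedPlanarOrderLayeredHullPoint.stub_layeredHullPoint
      x a ha₁ ha₂ hW
  refine ⟨X, 39 / 50 * a, 2 * a, a, by linarith, hsep, hdense, hhull, fun c => ⟨t₁, t₂, by linarith, by linarith,
    by linarith, hind, fun p hp _ => ?_⟩⟩
  obtain ⟨h1, h2, h3, h4⟩ := hper p hp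
  have hq : ∀ q : EuclideanSpace ℝ (Fin 3), q ∈ X → ∃ q' ∈ X, dist q q' ≤ 39 / 50 * a / 4 :=
    fun q hq => ⟨q, hq, by rw [dist_self]; linarith⟩
  exact ⟨hq _ h1, hq _ h2, hq _ h3, hq _ h4⟩

/-- With `PeriodicGivenLayered` (stmt-11779, closed) by name: T → L → periodic windows along every ground-state sequence
with `b_N → 0` (the clean-majority world; = lens-5's `FractionsFrameAlong ∧ StrainedCase` world). [folklore] -/
theorem periodicWindowsAlongCleanMajority_of_palmDoor (h79 : Theses.HullMinimality.PeriodicGivenLayered)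
    (hT : Theses.ChartedPlanarOrder.MinimisingLawTransfer)
    (hL : Theses.ChartedPlanarOrder.CleanLawsChargeLayers) :
    ∀ x : (N : ℕ) → (Fin N → EuclideanSpace ℝ (Fin 3)), (∀ N, Literature.MathematicalPhysics.StatisticalMechanics.IsGroundState Literature.MathematicalPhysics.StatisticalMechanics.lennardJones (x N)) → Filter.Tendsto (fun N : ℕ => (Nat.card {i : Fin N // ¬ Literature.Geometry.DiscreteGeometry.IsTwoShellGood (1 / 20) (47 / 50) 1 (x N) i} : ℝ) / N) Filter.atTop (nhds 0) → ∃ P : Literature.MathematicalPhysics.StatisticalMechanics.PeriodicConfiguration 3, ∀ R ε : ℝ, 0 < ε → ∃ᶠ N in Filter.atTop, ∃ t : EuclideanSpace ℝ (Fin 3), (∀ s ∈ P.points, ‖s‖ ≤ R → ∃ i : Fin N, dist (x N i + t) s ≤ ε) ∧ (∀ i : Fin N, ‖x N i + t‖ ≤ R → ∃ s ∈ P.points, dist (x N i + t) s ≤ ε) :=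
  fun x hx hb => h79 x hx (layeredWindowsAlong_of_palmDoor hT hL x hx hb)

/-- CONSOLIDATION: lens-2's `CleanBallCase` (stmt-26136) ⟸ `NashNearField` (stmt-16827) ∧ `PeriodicGivenLayered`
(stmt-11779, closed) DIRECTLY — no lens-3 rung is in its cone. [folklore] -/
theorem cleanBallCase_of_nashNearField_direct (h79 : Theses.HullMinimality.PeriodicGivenLayered)
    (hNF : Theses.NashClassCertificates.NashNearField) : Theses.MatrixSaturationDichotomy.CleanBallCase :=
  fun x hx _ hk => h79 x hx (Theorems.ChartedPlanarOrderNnfDoor.stub_nnfDoor hNF x hx hk)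

end Summit.AtomisticToContinuum.Crystallization.Theorems.ChartedPlanarOrderPalmDoor
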